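import Mathlib

/-!
# Route `GreenTaoLevelTwo`, crux `MNTwo` (stmt-Parity-21276), line `birth`, stub `stub_mnVertical`:
# the cosine-power kernel on the circle (one-dimensional tools for AIF Lemma 37)

Tools for the Fourier expansion of Bohr-gauge Lipschitz cutoffs (B. Green, T. Tao, *Quadratic
uniformity of the Möbius function*, Ann. Inst. Fourier 58 (2008) = arXiv:math/0606087, App. A
Lemma 37 "Fourier approximation of Lipschitz functions"), in a DISCRETE form that avoids integration:
the kernel `K_R(t) = (4^R / binom(2R,R)) cos(π t)^{2R} = ∑_{j=0}^{2R} (binom(2R,j)/binom(2R,R)) e((j-R)t)`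
is a non-negative trigonometric polynomial of degree `R` with coefficients in `[0,1]` and constant
coefficient `1`; hence its average over any grid `x - u/M` (`u < M`, `M > R`) is exactly `1`, and since
`cos(πt)² ≤ 1 - 4‖t‖²_{ℝ/ℤ}` it is `≤ 1/(4 s⁴ R)` where `‖t‖_{ℝ/ℤ} ≥ s`; consequently the grid average
of `‖t‖_{ℝ/ℤ} K_R(t)` is `≤ s + 1/(8 s⁴ R)` for every `s > 0`.  Def-free (the kernel is written out).

* `two_cos_pow_eq_sum` — `(2cos(πt))^{2R}` as an exponential sum;
* `sum_range_exp_eq_zero` — orthogonality of characters on `ℤ/Mℤ`;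
* `sum_two_cos_pow_grid` — `∑_{u<M} (2cos(π(x-u/M)))^{2R} = binom(2R,R)·M` for `R < M`;
* `two_mul_norm_le_abs_sin`, `cos_sq_le` — `2‖t‖ ≤ |sin(πt)|`, `cos(πt)² ≤ 1 - 4‖t‖²`;
* `cosKernel_le_of_le_norm` — decay away from `0` (`≤ 1/(4s⁴R)` where `‖t‖ ≥ s`);
* `sum_norm_mul_cosKernel_grid_le` — the weighted grid average.

References: [GreenTao2008QuadraticMobius] arXiv:math/0606087 App. A (Lemma 37).
-/

noncomputable section

open Finset Real

namespace Summit.Parity.GeneralizedHardyLittlewood.GreenTaoLevelTwoMNTwoCosKernel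

/-! ### §1 The kernel as an exponential sum -/

/-- `(2 cos(πt))^{2R} = ∑_{j=0}^{2R} binom(2R,j) e((j-R)t)`. [folklore] -/
theorem two_cos_pow_eq_sum (R : ℕ) (t : ℝ) :
    (((2 * Real.cos (π * t)) ^ (2 * R) : ℝ) : ℂ) =
      ∑ j ∈ range (2 * R + 1), ((2 * R).choose j : ℂ) *
        Complex.exp (((2 * π * ((j - R : ℝ) * t) : ℝ) : ℂ) * Complex.I) := by
  have h2cos : (((2 * Real.cos (π * t)) : ℝ) : ℂ) =
      Complex.exp (((π * t : ℝ) : ℂ) * Complex.I) + Complex.exp (-((π * t : ℝ) : ℂ) * Complex.I) := by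
    rw [← Complex.two_cos]
    push_cast
    rfl
  rw [Complex.ofReal_pow, h2cos, add_pow]
  refine Finset.sum_congr rfl fun j hj => ?_
  have hj' : j ≤ 2 * R := Nat.lt_succ_iff.mp (Finset.mem_range.mp hj)
  rw [← Complex.exp_nat_mul, ← Complex.exp_nat_mul, ← Complex.exp_add, mul_comm]
  congr 1
  push_cast [Nat.cast_sub hj']
  ring

/-! ### §2 Orthogonality on `ℤ/Mℤ` -/

/-- `∑_{u<M} e(r u / M) = 0` when `M ∤ r`. [folklore] -/
theorem sum_range_exp_eq_zero {M : ℕ} (hM : 0 < M) {r : ℤ} (hr : ¬ ((M : ℤ) ∣ r)) :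
    ∑ u ∈ range M, Complex.exp (((2 * π * ((r : ℝ) * u / M) : ℝ) : ℂ) * Complex.I) = 0 := by
  set ζ : ℂ := Complex.exp (((2 * π * ((r : ℝ) / M) : ℝ) : ℂ) * Complex.I) with hζ
  have hterm : ∀ u : ℕ,
      Complex.exp (((2 * π * ((r : ℝ) * u / M) : ℝ) : ℂ) * Complex.I) = ζ ^ u := by
    intro u
    rw [hζ, ← Complex.exp_nat_mul]
    congr 1
    push_cast
    ring
  simp_rw [hterm]
  have hMC : (M : ℂ) ≠ 0 := by exact_mod_cast hM.ne'
  have hζM : ζ ^ M = 1 := by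
    rw [hζ, ← Complex.exp_nat_mul]
    have : (M : ℂ) * ((((2 * π * ((r : ℝ) / M)) : ℝ) : ℂ) * Complex.I) = r * (2 * π * Complex.I) := by
      push_cast
      field_simp
    rw [this]
    exact Complex.exp_int_mul_two_pi_mul_I r
  have hζ1 : ζ ≠ 1 := by
    intro h
    rw [hζ, Complex.exp_eq_one_iff] at h
    obtain ⟨n, hn⟩ := h
    apply hr
    have hI : (2 * π * Complex.I) ≠ 0 := by simp [Real.pi_ne_zero, Complex.I_ne_zero]
    have h3 : (2 * π * Complex.I) * ((((r : ℝ) / M : ℝ)) : ℂ) = (2 * π * Complex.I) * (n : ℂ) := by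
      rw [mul_comm _ (n : ℂ), ← hn]
      push_cast
      ring
    have h4 := mul_left_cancel₀ hI h3
    have h5 : ((r : ℝ) / M : ℝ) = (n : ℝ) := by exact_mod_cast h4
    have hMR : (M : ℝ) ≠ 0 := by exact_mod_cast hM.ne'
    rw [div_eq_iff hMR] at h5
    refine ⟨n, ?_⟩
    have h6 : (r : ℝ) = ((M * n : ℤ) : ℝ) := by push_cast; rw [h5]; ring
    exact_mod_cast h6
  rw [geom_sum_eq hζ1, hζM, sub_self, zero_div]

/-! ### §3 Exact normalisation on grids -/

/-- `∑_{u<M} (2cos(π(x - u/M)))^{2R} = binom(2R,R) · M` for `R < M`. [folklore] -/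
theorem sum_two_cos_pow_grid {R M : ℕ} (hRM : R < M) (x : ℝ) :
    ∑ u ∈ range M, (2 * Real.cos (π * (x - u / M))) ^ (2 * R) = ((2 * R).choose R : ℝ) * M := by
  have hM : 0 < M := lt_of_le_of_lt (Nat.zero_le R) hRM
  apply Complex.ofReal_injective
  push_cast
  have step1 : ∀ u : ℕ, (((2 * Real.cos (π * (x - u / M))) ^ (2 * R) : ℝ) : ℂ) =
      ∑ j ∈ range (2 * R + 1), ((2 * R).choose j : ℂ) *
        (Complex.exp (((2 * π * ((j - R : ℝ) * x) : ℝ) : ℂ) * Complex.I) *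
          Complex.exp (((2 * π * ((((R : ℤ) - j : ℤ) : ℝ) * u / M) : ℝ) : ℂ) * Complex.I)) := by
    intro u
    rw [two_cos_pow_eq_sum]
    refine Finset.sum_congr rfl fun j _ => ?_
    congr 1
    rw [← Complex.exp_add]
    congr 1
    push_cast
    ring
  have step1' : ∀ u : ℕ, ((2 : ℂ) * Complex.cos (π * (x - u / M))) ^ (2 * R) =
      ∑ j ∈ range (2 * R + 1), ((2 * R).choose j : ℂ) *
        (Complex.exp (((2 * π * ((j - R : ℝ) * x) : ℝ) : ℂ) * Complex.I) *
          Complex.exp (((2 * π * ((((R : ℤ) - j : ℤ) : ℝ) * u / M) : ℝ) : ℂ) * Complex.I)) := by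
    intro u
    rw [← step1 u]
    push_cast
    rfl
  simp_rw [step1']
  rw [Finset.sum_comm]
  simp_rw [← Finset.mul_sum]
  rw [Finset.sum_eq_single_of_mem R (by simp; omega)]
  · have h0 : ∀ u : ℕ,
        Complex.exp (((2 * π * ((((R : ℤ) - R : ℤ) : ℝ) * u / M) : ℝ) : ℂ) * Complex.I) = 1 := by
      intro u; simp
    simp_rw [h0]
    simp
  · intro j hj hjR
    have hj' : j ≤ 2 * R := Nat.lt_succ_iff.mp (Finset.mem_range.mp hj)
    have hndvd : ¬ ((M : ℤ) ∣ ((R : ℤ) - j)) := by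
      intro hdvd
      rcases hdvd with ⟨c, hc⟩
      rcases lt_trichotomy c 0 with hc0 | hc0 | hc0
      · have : (M : ℤ) * c ≤ (M : ℤ) * (-1) := by
          exact mul_le_mul_of_nonneg_left (by omega) (by positivity)
        omega
      · subst hc0; simp at hc; omega
      · have : (M : ℤ) * 1 ≤ (M : ℤ) * c := by
          exact mul_le_mul_of_nonneg_left (by omega) (by positivity)
        omega
    rw [sum_range_exp_eq_zero hM hndvd, mul_zero, mul_zero]

/-! ### §4 Decay away from the origin -/

/-- `2‖t‖_{ℝ/ℤ} ≤ |sin(πt)|` (Jordan's inequality, periodised). [folklore] -/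
theorem two_mul_norm_le_abs_sin (t : ℝ) :
    2 * ‖((t : ℝ) : AddCircle (1 : ℝ))‖ ≤ |Real.sin (π * t)| := by
  have hnorm : ‖((t : ℝ) : AddCircle (1 : ℝ))‖ = |t - round t| := by
    rw [AddCircle.norm_eq]; simp
  rw [hnorm]
  set y : ℝ := t - round t with hy
  have hy2 : |y| ≤ 1 / 2 := abs_sub_round t
  have hsin : |Real.sin (π * t)| = |Real.sin (π * y)| := by
    have ht : π * t = π * y + (round t : ℤ) * π := by rw [hy]; ring
    rw [ht, Real.sin_add_int_mul_pi, abs_mul]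
    have : |((-1 : ℝ)) ^ (round t)| = 1 := by
      rw [abs_zpow, abs_neg, abs_one, one_zpow]
    rw [this, one_mul]
  rw [hsin]
  -- Jordan on `[0, π/2]` applied to `π|y|`
  have hJ : 2 / π * (π * |y|) ≤ Real.sin (π * |y|) :=
    Real.mul_le_sin (by positivity) (by nlinarith [Real.pi_pos])
  have hJ' : 2 * |y| ≤ Real.sin (π * |y|) := by
    have : 2 / π * (π * |y|) = 2 * |y| := by field_simp
    linarith
  refine hJ'.trans ?_
  rcases le_or_gt 0 y with h0 | h0
  · rw [abs_of_nonneg h0]; exact le_abs_self _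
  · rw [abs_of_neg h0, mul_neg, Real.sin_neg]; exact neg_le_abs _

/-- `cos(πt)² ≤ 1 - 4‖t‖²_{ℝ/ℤ}`. [folklore] -/
theorem cos_sq_le (t : ℝ) :
    Real.cos (π * t) ^ 2 ≤ 1 - 4 * ‖((t : ℝ) : AddCircle (1 : ℝ))‖ ^ 2 := by
  have h := two_mul_norm_le_abs_sin t
  have h2 : (2 * ‖((t : ℝ) : AddCircle (1 : ℝ))‖) ^ 2 ≤ |Real.sin (π * t)| ^ 2 :=
    pow_le_pow_left₀ (by positivity) h 2
  rw [sq_abs] at h2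
  rw [Real.cos_sq']
  nlinarith

/-- **Decay of the cosine-power kernel.**  For `R ≥ 1` and `‖t‖_{ℝ/ℤ} ≥ s > 0`,
`(4^R/binom(2R,R)) cos(πt)^{2R} ≤ 1/(4 s⁴ R)`. [folklore] -/
theorem cosKernel_le_of_le_norm {R : ℕ} (hR : 1 ≤ R) {s t : ℝ} (hs : 0 < s)
    (hst : s ≤ ‖((t : ℝ) : AddCircle (1 : ℝ))‖) :
    (4 : ℝ) ^ R / (Nat.centralBinom R : ℝ) * Real.cos (π * t) ^ (2 * R) ≤ 1 / (4 * s ^ 4 * R) := by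
  set τ : ℝ := ‖((t : ℝ) : AddCircle (1 : ℝ))‖ with hτ
  have hτ0 : 0 ≤ τ := norm_nonneg _
  -- the prefactor
  have hcb : (0 : ℝ) < (Nat.centralBinom R : ℝ) := by exact_mod_cast Nat.centralBinom_pos R
  have hpre : (4 : ℝ) ^ R / (Nat.centralBinom R : ℝ) ≤ 2 * R := by
    rw [div_le_iff₀ hcb]
    exact_mod_cast Nat.four_pow_le_two_mul_self_mul_centralBinom R hR
  -- the power
  have hcos2 : Real.cos (π * t) ^ 2 ≤ 1 - 4 * τ ^ 2 := cos_sq_le t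
  have h14 : 0 ≤ 1 - 4 * τ ^ 2 := le_trans (sq_nonneg _) hcos2
  have hpow : Real.cos (π * t) ^ (2 * R) ≤ (1 - 4 * τ ^ 2) ^ R := by
    rw [pow_mul]
    exact pow_le_pow_left₀ (sq_nonneg _) hcos2 R
  have hexp1 : (1 - 4 * τ ^ 2) ^ R ≤ Real.exp (-(4 * τ ^ 2 * R)) := by
    have h1 : 1 - 4 * τ ^ 2 ≤ Real.exp (-(4 * τ ^ 2)) := by
      have := Real.add_one_le_exp (-(4 * τ ^ 2)); linarith
    calc (1 - 4 * τ ^ 2) ^ R ≤ Real.exp (-(4 * τ ^ 2)) ^ R := pow_le_pow_left₀ h14 h1 R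
      _ = Real.exp (-(4 * τ ^ 2 * R)) := by rw [← Real.exp_nat_mul]; ring_nf
  have hsτ : 4 * s ^ 2 * R ≤ 4 * τ ^ 2 * R := by
    have : s ^ 2 ≤ τ ^ 2 := pow_le_pow_left₀ hs.le hst 2
    have hR0 : (0 : ℝ) ≤ R := Nat.cast_nonneg R
    nlinarith
  have hexp2 : Real.exp (-(4 * τ ^ 2 * R)) ≤ Real.exp (-(4 * s ^ 2 * R)) :=
    Real.exp_le_exp.mpr (by linarith)
  have hR1 : (1 : ℝ) ≤ R := by exact_mod_cast hR
  have hz : 0 < 4 * s ^ 2 * R := by positivity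
  have hexp3 : Real.exp (-(4 * s ^ 2 * R)) ≤ 2 / (4 * s ^ 2 * R) ^ 2 := by
    -- `exp(-z) ≤ 2/z²` (tree: `Literature.NumberTheory.Automorphic.exp_neg_le_two_div_sq`, inlined)
    have h := Real.pow_div_factorial_le_exp (4 * s ^ 2 * R) hz.le 2
    rw [Nat.factorial_two, Nat.cast_ofNat] at h
    rw [Real.exp_neg, inv_eq_one_div, div_le_div_iff₀ (Real.exp_pos _) (by positivity)]
    linarith
  have hcosR : 0 ≤ Real.cos (π * t) ^ (2 * R) := by rw [pow_mul]; positivity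
  calc (4 : ℝ) ^ R / (Nat.centralBinom R : ℝ) * Real.cos (π * t) ^ (2 * R)
      ≤ (2 * R) * (2 / (4 * s ^ 2 * R) ^ 2) := by
        refine mul_le_mul hpre (hpow.trans (hexp1.trans (hexp2.trans hexp3))) hcosR (by positivity)
    _ = 1 / (4 * s ^ 4 * R) := by field_simp; ring

/-! ### §5 The weighted grid average -/

/-- **Weighted grid average of the cosine-power kernel.**  For `1 ≤ R < M`, `s > 0` and every `x`,
`(1/M) ∑_{u<M} ‖x - u/M‖_{ℝ/ℤ} K_R(x - u/M) ≤ s + 1/(8 s⁴ R)` where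
`K_R(t) = (4^R/binom(2R,R)) cos(πt)^{2R}`. [folklore] -/
theorem sum_norm_mul_cosKernel_grid_le {R M : ℕ} (hR : 1 ≤ R) (hRM : R < M) {s : ℝ} (hs : 0 < s)
    (x : ℝ) :
    (∑ u ∈ range M, ‖(((x - u / M : ℝ)) : AddCircle (1 : ℝ))‖ *
        ((4 : ℝ) ^ R / (Nat.centralBinom R : ℝ) * Real.cos (π * (x - u / M)) ^ (2 * R))) / M ≤
      s + 1 / (8 * s ^ 4 * R) := by
  have hM : 0 < M := lt_of_le_of_lt (Nat.zero_le R) hRM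
  have hMr : (0 : ℝ) < M := by exact_mod_cast hM
  have hcb : (0 : ℝ) < (Nat.centralBinom R : ℝ) := by exact_mod_cast Nat.centralBinom_pos R
  -- total mass `M`
  have hmass : ∑ u ∈ range M,
      (4 : ℝ) ^ R / (Nat.centralBinom R : ℝ) * Real.cos (π * (x - u / M)) ^ (2 * R) = M := by
    have h := sum_two_cos_pow_grid (R := R) hRM x
    have e : ∀ u : ℕ, (4 : ℝ) ^ R / (Nat.centralBinom R : ℝ) * Real.cos (π * (x - u / M)) ^ (2 * R)
        = (1 / (Nat.centralBinom R : ℝ)) * (2 * Real.cos (π * (x - u / M))) ^ (2 * R) := by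
      intro u
      rw [mul_pow, pow_mul (2 : ℝ) 2 R]; norm_num; ring
    simp_rw [e, ← Finset.mul_sum, h, Nat.centralBinom]
    have hc : ((2 * R).choose R : ℝ) ≠ 0 := by
      have := Nat.centralBinom_pos R
      rw [Nat.centralBinom] at this
      exact_mod_cast this.ne'
    field_simp
  -- termwise bound
  have hterm : ∀ u ∈ range M,
      ‖(((x - u / M : ℝ)) : AddCircle (1 : ℝ))‖ *
          ((4 : ℝ) ^ R / (Nat.centralBinom R : ℝ) * Real.cos (π * (x - u / M)) ^ (2 * R)) ≤
        s * ((4 : ℝ) ^ R / (Nat.centralBinom R : ℝ) * Real.cos (π * (x - u / M)) ^ (2 * R)) +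
          1 / (8 * s ^ 4 * R) := by
    intro u _
    set Ku := (4 : ℝ) ^ R / (Nat.centralBinom R : ℝ) * Real.cos (π * (x - u / M)) ^ (2 * R) with hKu
    have hK0 : 0 ≤ Ku := by rw [hKu, pow_mul]; positivity
    have hc0 : 0 ≤ 1 / (8 * s ^ 4 * R) := by positivity
    rcases le_or_gt (‖(((x - u / M : ℝ)) : AddCircle (1 : ℝ))‖) s with hle | hgt
    · nlinarith [mul_le_mul_of_nonneg_right hle hK0]
    · have hKle : Ku ≤ 1 / (4 * s ^ 4 * R) := cosKernel_le_of_le_norm hR hs hgt.le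
      have hhalf : ‖(((x - u / M : ℝ)) : AddCircle (1 : ℝ))‖ ≤ 1 / 2 := by
        have := AddCircle.norm_le_half_period (1 : ℝ) (x := (((x - u / M : ℝ)) : AddCircle (1 : ℝ)))
          one_ne_zero
        simpa using this
      have h1 : ‖(((x - u / M : ℝ)) : AddCircle (1 : ℝ))‖ * Ku ≤ 1 / 2 * (1 / (4 * s ^ 4 * R)) :=
        mul_le_mul hhalf hKle hK0 (by norm_num)
      have h2 : 1 / 2 * (1 / (4 * s ^ 4 * R)) = 1 / (8 * s ^ 4 * R) := by ring
      nlinarith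
  have hsum := Finset.sum_le_sum hterm
  rw [Finset.sum_add_distrib, ← Finset.mul_sum, hmass, Finset.sum_const, Finset.card_range,
    nsmul_eq_mul] at hsum
  rw [div_le_iff₀ hMr]
  have : (s + 1 / (8 * s ^ 4 * R)) * M = s * M + M * (1 / (8 * s ^ 4 * R)) := by ring
  linarith

end Summit.Parity.GeneralizedHardyLittlewood.GreenTaoLevelTwoMNTwoCosKernel
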